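import Literature.AlgebraicGeometry.HodgeTheory.AlgebraicClassesPullbackHolds
import Literature.AlgebraicGeometry.HodgeTheory.FermatCohomologyCurvePowerDomination
import Literature.AlgebraicGeometry.HodgeTheory.HodgeGenericQbarDescentFiniteMonodromyInputs
import Literature.AlgebraicGeometry.HodgeTheory.BettiUniverseCupChainMatchings
import Literature.AlgebraicGeometry.HodgeTheory.AlgebraicClassesLiftAlongMorphisms
import Literature.AlgebraicGeometry.HodgeTheory.MotivatedClassesHodgeConjecture
import Literature.AlgebraicGeometry.HodgeTheory.DworkSexticReflectionTransfer
import Literature.AlgebraicGeometry.HodgeTheory.DworkSexticReflectionQuotient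
import Literature.AlgebraicGeometry.HodgeTheory.HomologicalNumericalEquivalenceOfLefschetzStandard
import HarnessLib

/-!
# Hypothesis-free forms of further consumers of Fulton's Cor. 19.2 (b) and Voisin II Prop. 9.20

Topic `Literature/AlgebraicGeometry/HodgeTheory`. THEOREMS ONLY (no definition, no named fact). Third
file of the series `AlgebraicClassesPullbackConsequences*`: the theorems of
`FermatCohomologyCurvePowerDomination` (Fermat varieties dominated by powers of curves),
`HodgeGenericQbarDescentFiniteMonodromyInputs` (Voisin 2007: algebraicity of the Hodge locus / finite
monodromy descent to `ℚ̄`, classical inputs), `BettiUniverseCupChainMatchings`,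
`AlgebraicClassesLiftAlongMorphisms`, `MotivatedClassesHodgeConjecture` (André's motivated classes and
the Hodge conjecture), `DworkSexticReflectionTransfer` / `DworkSexticReflectionQuotient`,
`HomologicalNumericalEquivalenceOfLefschetzStandard`, which
carry the pull-back fact `fulton1998_map_mem_algebraicClasses` (`hF`, `hFul`, `hpull`) or the
cup-product fact `Voisin2003_cupProduct_algebraicClasses` (`hcup`, `hV`) as explicit hypotheses,
restated WITHOUT them — primed names, statements otherwise verbatim, proofs by the discharges
`fulton1998_map_mem_algebraicClasses_holds'` / `Voisin2003_cupProduct_algebraicClasses_holds'`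
(`AlgebraicClassesPullbackHolds`). Theorems carrying BOTH facts are primed once per fact (the other
kept). Other named-fact hypotheses are kept as printed.

## References

* [Fulton1998] W. Fulton, Intersection Theory, 2nd ed. (1998), §19.2 Cor. 19.2 (b).
* [VoisinHodgeII2003] C. Voisin, Hodge Theory and Complex Algebraic Geometry II (2003), §9.2.4 Prop. 9.20.
* [Voisin2007HodgeLoci] C. Voisin, Hodge loci and absolute Hodge classes, Compos. Math. 143 (2007).
* [Andre1996Motifs] Y. André, Pour une théorie inconditionnelle des motifs, Publ. Math. IHÉS 83 (1996).
-/

noncomputable section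

open CategoryTheory AlgebraicGeometry MonoidalCategory
open Literature.AlgebraicTopology.SingularHomology
open Literature.AlgebraicGeometry.Motives
open CategoryTheory AlgebraicGeometry
open _root_.Topology
open CategoryTheory CategoryTheory.Limits
open CategoryTheory AlgebraicGeometry MonoidalCategory CartesianMonoidalCategory
open Literature.AlgebraicGeometry.Motives (IsSmoothProjective AbelianVariety)
open Literature.AlgebraicTopology.SingularHomology Literature.Geometry.Kaehler
open CategoryTheory AlgebraicGeometry MvPolynomial Set
open scoped LinearAlgebra.Projectivization
open Literature.AlgebraicGeometry.Motives Literature.AlgebraicGeometry.RelativeSpec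
open Literature.AlgebraicTopology.SingularHomology Literature.AlgebraicTopology.Homotopy
open Literature.NumberTheory.Transcendental
open CategoryTheory AlgebraicGeometry MvPolynomial
open scoped Manifold ContDiff
open CategoryTheory AlgebraicGeometry MonoidalCategory Module Finset

namespace Literature.AlgebraicGeometry.HodgeTheory

/-! ### From `FermatCohomologyCurvePowerDomination` -/

/-- (Hypothesis-free form of `complexGysin_map_mem_algebraicClasses_of_pullbackAlgebraic`: `fulton1998_map_mem_algebraicClasses` is now a Literature
theorem, `fulton1998_map_mem_algebraicClasses_holds'`.) **The `alg → alg` clause of the main span from Fulton's Cor. 19.2 (b).** For a span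
`M ←b— Z —f→ V` of smooth projective varieties, `f_* ∘ b^*` carries `algebraicClasses M k` into
`algebraicClasses V c`, `k + dim V = c + dim Z`, as soon as pull-backs along ARBITRARY morphisms of
smooth projective varieties preserve algebraic classes — the tree's named fact
`fulton1998_map_mem_algebraicClasses` (Fulton, Cor. 19.2 (b): "`cl` … contravariant for morphisms of
non-singular varieties"), needed here because the blow-up `b = β × id` of the diagram (1.25) `× W`
is not flat (the flat case is the theorem `complexGysin_map_mem_algebraicClasses_of_flat`); the
push-forward half is the proved support form of the Gysin morphism
(`complexGysin_mem_algebraicClasses`, Fulton, *Young Tableaux* App. B §B.2). This is the hypothesis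
`hbalg` of `inductiveStepClause_of_spans`.
[cite: Fulton1998, §19.2 Cor. 19.2 (b) and Ch. 16 Def. 16.1.2] [cite: ShiodaKatsura1979, §2 (2.17)–(2.19)] -/
theorem complexGysin_map_mem_algebraicClasses_of_pullbackAlgebraic'
    (μ : OrientationFamily) {dZ dM dV : ℕ} {Z M V : Motives.SchemeOver ℂ}
    (hZ : IsSmoothProjective dZ Z) (hM : IsSmoothProjective dM M) (hV : IsSmoothProjective dV V)
    (b : Z ⟶ M) (f : Z ⟶ V) {k c : ℕ} (hc : k + dV = c + dZ) {x : complexBetti M (2 * k)}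
    (hx : x ∈ algebraicClasses M k) :
    complexGysin μ hZ hV f (show 2 * k + 2 * dV = 2 * c + 2 * dZ by omega) (complexBetti.map b (2 * k) x) ∈ algebraicClasses V c :=
  complexGysin_map_mem_algebraicClasses_of_pullbackAlgebraic μ fulton1998_map_mem_algebraicClasses_holds' hZ hM hV b f hc hx

/-- (Hypothesis-free form of `inductiveStepClause_of_blowupDiagram`: `fulton1998_map_mem_algebraicClasses` is now a Literature
theorem, `fulton1998_map_mem_algebraicClasses_holds'`.) **One clause of `hA`/`hB` from the blow-up diagram (1.25) `× W`, its two cohomological inputs,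
and Fulton's Cor. 19.2 (b).** What a proof of the one-step statement (the hypotheses `hA`, `hB` of
`FermatHodgeClassesLiftToCurvePowersSum_of_inductiveStep`) has to supply at `(V, M, P, c)` is
exactly: the varieties and morphisms of the diagram as smooth projective `ℂ`-schemes — `Z` (the
blow-up `× W`, of dimension `dim V`), `b`, `f`, the exceptional divisors `Eₜ` (dimension `dim P + 1`)
with FLAT `πₜ : Eₜ ⟶ P` and `jₜ : Eₜ ⟶ Z` (Thm. 1.7; Remark 1.9 for the first step; (2.18)) —, the
blow-up formula on `Z` (Lemma 2.1, spanning half: `hZspan`), the surjectivity of `f_* = (ψ × id)_*`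
((2.3)–(2.9), (2.17): `hf`), and the contravariance of algebraic classes along the non-flat `b`
(the named fact `fulton1998_map_mem_algebraicClasses`, Fulton Cor. 19.2 (b): `hF`). Then `Ψ = u • f_* b^*`
and `Θₜ = uₜ • (jₜ ≫ f)_* πₜ^*` do it (`inductiveStepClause_of_spans`).
[cite: ShiodaKatsura1979, §1 Thm. 1.7 (1.25), Remark 1.9; §2 Lemma 2.1, Prop. 2.4 (2.5), Cor. 2.5 (2.9), (2.17)–(2.19)]
[cite: VoisinHodgeI2002, Thm. 7.31 and §7.3.2] [cite: Fulton1998, Ch. 16 Def. 16.1.2 and §19.2 Cor. 19.2 (b)] -/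
theorem inductiveStepClause_of_blowupDiagram'
    (μ : OrientationFamily) {V M P Z : Motives.SchemeOver ℂ} {dV dP : ℕ}
    (hV : IsSmoothProjective dV V) (hM : IsSmoothProjective dV M) (hP : IsSmoothProjective dP P)
    (hdP : dP + 2 = dV) (c : ℕ) (hZ : IsSmoothProjective dV Z) (b : Z ⟶ M) (f : Z ⟶ V) {T : Type}
    [Fintype T] {E : T → Motives.SchemeOver ℂ} (hE : ∀ t, IsSmoothProjective (dP + 1) (E t))
    (π : ∀ t, E t ⟶ P) [∀ t, Flat (π t).left] (j : ∀ t, E t ⟶ Z)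
    (hZspan : ∀ z : complexBetti Z (2 * c), z ∈ LinearMap.range (complexBetti.map b (2 * c)).hom ⊔ ⨆ (c₀ : ℕ) (h : c₀ + 1 = c) (t : T), LinearMap.range (complexGysin μ (hE t) hZ (j t) (show 2 * c₀ + 2 * dV = 2 * c + 2 * (dP + 1) by omega) ∘ₗ (complexBetti.map (π t) (2 * c₀)).hom))
    (hf : Function.Surjective (complexGysin μ hZ hV f (show 2 * c + 2 * dV = 2 * c + 2 * dV from rfl))) :
    ∃ (Ψ : complexBetti M (2 * c) →ₗ[ℂ] complexBetti V (2 * c)) (T' : Type) (_ : Fintype T') (Θ : ∀ c₀ : ℕ, c₀ + 1 = c → T' → (complexBetti P (2 * c₀) →ₗ[ℂ] complexBetti V (2 * c))), (∀ x ∈ algebraicClasses M c, Ψ x ∈ algebraicClasses V c) ∧ (∀ x, IsRationalClass x → IsRationalClass (Ψ x)) ∧ (∀ ⦃a b : ℕ⦄ ⦃x⦄, a + b = 2 * c → IsOfHodgeType dV M (2 * c) a b x → IsOfHodgeType dV V (2 * c) a b (Ψ x)) ∧ (∀ c₀ (h : c₀ + 1 = c) (t : T'), (∀ y ∈ algebraicClasses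 P c₀, Θ c₀ h t y ∈ algebraicClasses V c) ∧ (∀ y, IsRationalClass y → IsRationalClass (Θ c₀ h t y)) ∧ (∀ ⦃a b : ℕ⦄ ⦃y⦄, a + b = 2 * c₀ → IsOfHodgeType dP P (2 * c₀) a b y → IsOfHodgeType dV V (2 * c) (a + 1) (b + 1) (Θ c₀ h t y))) ∧ ∀ z : complexBetti V (2 * c), z ∈ LinearMap.range Ψ ⊔ ⨆ (c₀ : ℕ) (h : c₀ + 1 = c) (t : T'), LinearMap.range (Θ c₀ h t) :=
  inductiveStepClause_of_blowupDiagram μ fulton1998_map_mem_algebraicClasses_holds' hV hM hP hdP c hZ b f hE π j hZspan hf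

/-- (Hypothesis-free form of `inductiveStepClause_of_blowupDiagram_of_surjective`: `fulton1998_map_mem_algebraicClasses` is now a Literature
theorem, `fulton1998_map_mem_algebraicClasses_holds'`.) **One clause of `hA`/`hB` from the blow-up diagram (1.25) `× W` with a SURJECTIVE `f`, the
blow-up formula on `Z`, and Fulton's Cor. 19.2 (b).** The same as
`inductiveStepClause_of_blowupDiagram`, with its cohomological input `hf` (`f_* = (ψ × id)_*` onto,
in print from `ψ_* ψ^* = m`, `ψ` of degree `m`, (2.3)–(2.4)) DISCHARGED from the geometric
hypothesis that `f` is surjective: for a surjective morphism of smooth projective varieties `f^*`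
is one-to-one (Voisin I Lemma 7.28) and so its Poincaré transpose `f_*` is onto
(`complexGysin_surjective_of_surjective`, file `ComplexGysinSurjective`). In the diagram `ψ × id`
is onto because `ψ : Z → X^{r+2}ₘ` is (Lemma 1.3 (ii): the restriction of `ψ` to `Z - (S₀ ∪ S_∞)`
is a finite morphism onto `X^{r+s}ₘ - (X^{r-1}ₘ ∪ X^{s-1}ₘ)`, and `ψ` is proper). What is left of
the clause is: the diagram as smooth projective `ℂ`-schemes with `f` surjective and the `πₜ` flat,
the blow-up formula on `Z` (spanning half, `hZspan`), and `fulton1998_map_mem_algebraicClasses`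
(`hF`). [cite: ShiodaKatsura1979, §1 Lemma 1.3 (ii), Thm. 1.7 (1.25); §2 Lemma 2.1, (2.3)–(2.9), (2.17)–(2.19)]
[cite: VoisinHodgeI2002, §7.3.2 Lemma 7.28 and Thm. 7.31] [cite: Fulton1998, §19.2 Cor. 19.2 (b)] -/
theorem inductiveStepClause_of_blowupDiagram_of_surjective'
    (μ : OrientationFamily) {V M P Z : Motives.SchemeOver ℂ} {dV dP : ℕ}
    (hV : IsSmoothProjective dV V) (hM : IsSmoothProjective dV M) (hP : IsSmoothProjective dP P)
    (hdP : dP + 2 = dV) (c : ℕ) (hZ : IsSmoothProjective dV Z) (b : Z ⟶ M) (f : Z ⟶ V)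
    [Surjective f.left] {T : Type} [Fintype T] {E : T → Motives.SchemeOver ℂ}
    (hE : ∀ t, IsSmoothProjective (dP + 1) (E t)) (π : ∀ t, E t ⟶ P) [∀ t, Flat (π t).left]
    (j : ∀ t, E t ⟶ Z)
    (hZspan : ∀ z : complexBetti Z (2 * c), z ∈ LinearMap.range (complexBetti.map b (2 * c)).hom ⊔ ⨆ (c₀ : ℕ) (h : c₀ + 1 = c) (t : T), LinearMap.range (complexGysin μ (hE t) hZ (j t) (show 2 * c₀ + 2 * dV = 2 * c + 2 * (dP + 1) by omega) ∘ₗ (complexBetti.map (π t) (2 * c₀)).hom)) :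
    ∃ (Ψ : complexBetti M (2 * c) →ₗ[ℂ] complexBetti V (2 * c)) (T' : Type) (_ : Fintype T') (Θ : ∀ c₀ : ℕ, c₀ + 1 = c → T' → (complexBetti P (2 * c₀) →ₗ[ℂ] complexBetti V (2 * c))), (∀ x ∈ algebraicClasses M c, Ψ x ∈ algebraicClasses V c) ∧ (∀ x, IsRationalClass x → IsRationalClass (Ψ x)) ∧ (∀ ⦃a b : ℕ⦄ ⦃x⦄, a + b = 2 * c → IsOfHodgeType dV M (2 * c) a b x → IsOfHodgeType dV V (2 * c) a b (Ψ x)) ∧ (∀ c₀ (h : c₀ + 1 = c) (t : T'), (∀ y ∈ algebraicClasses P c₀, Θ c₀ h t y ∈ algebraicClasses V c) ∧ (∀ y, IsRationalClass y → IsRationalClass (Θ c₀ h t y)) ∧ (∀ ⦃a b : ℕ⦄ ⦃y⦄, a + b = 2 * c₀ → IsOfHodgeType dP P (2 * c₀) a b y → IsOfHodgeType dV V (2 * c) (a + 1) (b + 1) (Θ c₀ h t y))) ∧ ∀ z : complexBetti V (2 * c), z ∈ LinearMap.range Ψ ⊔ ⨆ (c₀ : ℕ) (h : c₀ + 1 =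 c) (t : T'), LinearMap.range (Θ c₀ h t) :=
  inductiveStepClause_of_blowupDiagram_of_surjective μ fulton1998_map_mem_algebraicClasses_holds' hV hM hP hdP c hZ b f hE π j hZspan

/-- (Hypothesis-free form of `FermatHodgeClassesLiftToCurvePowersSum_of_blowupDiagrams`: `fulton1998_map_mem_algebraicClasses` is now a Literature
theorem, `fulton1998_map_mem_algebraicClasses_holds'`.) **`FermatHodgeClassesLiftToCurvePowersSum` from `fulton1998_map_mem_algebraicClasses` and the
blow-up diagrams of Shioda–Katsura's Thm. 1.7 with their blow-up formula.** The residual input of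
the whole formalisation, in purely geometric-plus-Lemma-2.1 form. Hypothesis `hA'` (the first step,
Remark 1.9 `× W`: `X²ₘ` from `X¹ₘ × X¹ₘ`, centre `X⁰ₘ × X⁰ₘ × W` = `m²` copies of `W`) and `hB'`
(Thm. 1.7 at `(r + 1, 1)` `× W`, `r ≥ 1`: `X^{r+2}ₘ` from `X^{r+1}ₘ × X¹ₘ`, centre components
`Xʳₘ × W`) ask, for every `m ≥ 1`, every smooth projective auxiliary factor `W` and every
half-degree `c`, for: a smooth projective `Z` of the dimension of the target (in print the blow-up
(1.4) `× W`, Lemma 1.2) with a morphism `b` to the main host (`β × id`) and a SURJECTIVE morphism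
`f` to the target (`ψ × id`; `ψ` is onto by Lemma 1.3 (ii) and properness), finitely many smooth
projective `Eₜ` of dimension `dim P + 1` with FLAT `πₜ : Eₜ ⟶ P` and `jₜ : Eₜ ⟶ Z` (the exceptional
`ℙ¹`-bundles over the components of the centre, (1.6)), and the blow-up formula on `Z` in degree
`2c`, spanning half (Lemma 2.1 for a centre of codimension `2`:
`H²ᶜ(Z) = b^* H²ᶜ(M) + Σₜ jₜ,* πₜ^* H^{2c-2}(P)`), for some orientation family `μ`. Granted these
and Fulton's Cor. 19.2 (b) (`hF`, pull-back of algebraic classes along the non-flat `b`; equivalently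
Voisin II Prop. 9.20, `fulton1998_map_mem_algebraicClasses_iff_cupProduct`), each clause of the
one-step statement holds (`inductiveStepClause_of_blowupDiagram_of_surjective`: `Ψ = u • f_* b^*`,
`Θₜ = uₜ • (jₜ ≫ f)_* πₜ^*`, with `f_*` onto by `complexGysin_surjective_of_surjective`), and the
induction on `r` (`FermatHodgeClassesLiftToCurvePowersSum_of_inductiveStep`) gives the named fact.
[cite: ShiodaKatsura1979, §1 (1.4)–(1.6), Lemma 1.2, Lemma 1.3 (ii), Thm. 1.7 (1.25), Remark 1.9; §2 Lemma 2.1, Prop. 2.4 (2.5), Cor. 2.5 (2.9), (2.17)–(2.19); §3 p. 107–108]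
[cite: Fulton1998, §19.2 Cor. 19.2 (b)] [cite: VoisinHodgeI2002, Thm. 7.31 and §7.3.2 Lemma 7.28] [cite: Voisin2025, Cor. 2.12] -/
theorem FermatHodgeClassesLiftToCurvePowersSum_of_blowupDiagrams'
    (hA' : ∀ (m : ℕ), 1 ≤ m → ∀ (w : ℕ) (W : Motives.SchemeOver ℂ), IsSmoothProjective w W → ∀ (c : ℕ), ∃ (μ : OrientationFamily) (Z : Motives.SchemeOver ℂ) (hZ : IsSmoothProjective (2 + w) Z) (b : Z ⟶ (fermatHypersurface 1 m ⊗ fermatHypersurface 1 m) ⊗ W) (f : Z ⟶ fermatHypersurface 2 m ⊗ W) (_ : Surjective f.left) (T : Type) (_ : Fintype T) (E : T → Motives.SchemeOver ℂ) (hE : ∀ t, IsSmoothProjective (w + 1) (E t)) (π : ∀ t, E t ⟶ W) (_ : ∀ t, Flat (π t).left) (j : ∀ t, E t ⟶ Z), ∀ z : complexBetti Z (2 * c), z ∈ LinearMap.range (complexBetti.map b (2 * c)).hom ⊔ ⨆ (c₀ : ℕ) (h : c₀ + 1 = c) (t : T), LinearMap.range (complexGysin μ (hE t) hZ (j t) (show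 2 * c₀ + 2 * (2 + w) = 2 * c + 2 * (w + 1) by omega) ∘ₗ (complexBetti.map (π t) (2 * c₀)).hom))
    (hB' : ∀ (m r : ℕ), 1 ≤ m → 1 ≤ r → ∀ (w : ℕ) (W : Motives.SchemeOver ℂ), IsSmoothProjective w W → ∀ (c : ℕ), ∃ (μ : OrientationFamily) (Z : Motives.SchemeOver ℂ) (hZ : IsSmoothProjective (r + 2 + w) Z) (b : Z ⟶ (fermatHypersurface (r + 1) m ⊗ fermatHypersurface 1 m) ⊗ W) (f : Z ⟶ fermatHypersurface (r + 2) m ⊗ W) (_ : Surjective f.left) (T : Type) (_ : Fintype T) (E : T → Motives.SchemeOver ℂ) (hE : ∀ t, IsSmoothProjective (r + w + 1) (E t)) (π : ∀ t, E t ⟶ fermatHypersurface r m ⊗ W) (_ : ∀ t, Flat (π t).left) (j : ∀ t, E t ⟶ Z), ∀ z : complexBetti Z (2 * c), z ∈ LinearMap.range (complexBetti.map b (2 * c)).hom ⊔ ⨆ (c₀ : ℕ) (h : c₀ + 1 = c) (t : T), LinearMap.range (complexGysin μ (hE t) hZ (j t) (show 2 * c₀ + 2 * (r + 2 + w) = 2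 * c + 2 * (r + w + 1) by omega) ∘ₗ (complexBetti.map (π t) (2 * c₀)).hom)) :
    FermatHodgeClassesLiftToCurvePowersSum :=
  FermatHodgeClassesLiftToCurvePowersSum_of_blowupDiagrams fulton1998_map_mem_algebraicClasses_holds' hA' hB'

end Literature.AlgebraicGeometry.HodgeTheory

namespace Literature.AlgebraicGeometry.HodgeTheory

/-! ### From `FermatCohomologyCurvePowerDomination` -/

/-- (Hypothesis-free form of `inductiveStepClause_of_blowupDiagram_of_cupProduct`: `Voisin2003_cupProduct_algebraicClasses` is now a Literature
theorem, `Voisin2003_cupProduct_algebraicClasses_holds'`.) The same clause with Fulton's Cor. 19.2 (b) replaced by the EQUIVALENT input "cup products of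
algebraic classes are algebraic" (Voisin II Prop. 9.20, the tree's named fact
`Voisin2003_cupProduct_algebraicClasses`, towards which the tree's moving-lemma files work):
`fulton1998_map_mem_algebraicClasses_of_cupProduct` (file `AlgebraicClassesPullbackOfCupProduct`).
[cite: ShiodaKatsura1979, §1 Thm. 1.7 (1.25); §2 Lemma 2.1, (2.3)–(2.9), (2.17)–(2.19)]
[cite: VoisinHodgeII2003, §9.2.4 Prop. 9.20 and Prop. 9.21 (i)] [cite: Fulton1998, §19.2 Cor. 19.2 (b)] -/
theorem inductiveStepClause_of_blowupDiagram_of_cupProduct'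
    (μ : OrientationFamily) {V M P Z : Motives.SchemeOver ℂ} {dV dP : ℕ}
    (hV : IsSmoothProjective dV V) (hM : IsSmoothProjective dV M) (hP : IsSmoothProjective dP P)
    (hdP : dP + 2 = dV) (c : ℕ) (hZ : IsSmoothProjective dV Z) (b : Z ⟶ M) (f : Z ⟶ V)
    [Surjective f.left] {T : Type} [Fintype T] {E : T → Motives.SchemeOver ℂ}
    (hE : ∀ t, IsSmoothProjective (dP + 1) (E t)) (π : ∀ t, E t ⟶ P) [∀ t, Flat (π t).left]
    (j : ∀ t, E t ⟶ Z)
    (hZspan : ∀ z : complexBetti Z (2 * c), z ∈ LinearMap.range (complexBetti.map b (2 * c)).hom ⊔ ⨆ (c₀ : ℕ) (h : c₀ + 1 = c) (t : T), LinearMap.range (complexGysin μ (hE t) hZ (j t) (show 2 * c₀ + 2 * dV = 2 * c + 2 * (dP + 1) by omega) ∘ₗ (complexBetti.map (π t) (2 * c₀)).hom)) :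
    ∃ (Ψ : complexBetti M (2 * c) →ₗ[ℂ] complexBetti V (2 * c)) (T' : Type) (_ : Fintype T') (Θ : ∀ c₀ : ℕ, c₀ + 1 = c → T' → (complexBetti P (2 * c₀) →ₗ[ℂ] complexBetti V (2 * c))), (∀ x ∈ algebraicClasses M c, Ψ x ∈ algebraicClasses V c) ∧ (∀ x, IsRationalClass x → IsRationalClass (Ψ x)) ∧ (∀ ⦃a b : ℕ⦄ ⦃x⦄, a + b = 2 * c → IsOfHodgeType dV M (2 * c) a b x → IsOfHodgeType dV V (2 * c) a b (Ψ x)) ∧ (∀ c₀ (h : c₀ + 1 = c) (t : T'), (∀ y ∈ algebraicClasses P c₀, Θ c₀ h t y ∈ algebraicClasses V c) ∧ (∀ y, IsRationalClass y → IsRationalClass (Θ c₀ h t y)) ∧ (∀ ⦃a b : ℕ⦄ ⦃y⦄, a + b = 2 * c₀ → IsOfHodgeType dP P (2 * c₀) a b y → IsOfHodgeType dV V (2 * c) (a + 1) (b + 1) (Θ c₀ h t y))) ∧ ∀ z : complexBetti V (2 * c), z ∈ LinearMap.range Ψ ⊔ ⨆ (c₀ : ℕ) (h : c₀ + 1 =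 c) (t : T'), LinearMap.range (Θ c₀ h t) :=
  inductiveStepClause_of_blowupDiagram_of_cupProduct μ Voisin2003_cupProduct_algebraicClasses_holds' hV hM hP hdP c hZ b f hE π j hZspan

end Literature.AlgebraicGeometry.HodgeTheory

namespace Literature.AlgebraicGeometry.HodgeTheory

open Literature.AlgebraicGeometry.Motives
open Literature.AlgebraicGeometry.Motives Literature.AlgebraicGeometry.Resolution MonoidalCategory
open CategoryTheory.Limits
open Literature.AlgebraicGeometry.Motives Literature.AlgebraicGeometry.Resolution CategoryTheory.Limits

/-! ### From `HodgeGenericQbarDescentFiniteMonodromyInputs` -/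

/-- (Hypothesis-free form of `voisin2007_algebraic_of_finite_monodromyOrbit_of_qbar_of_riemannExistence`: `fulton1998_map_mem_algebraicClasses` is now a Literature
theorem, `fulton1998_map_mem_algebraicClasses_holds'`.) **Voisin 2007, Prop. 0.7 (= arXiv Prop. 1.7) from three named facts and the two theorems of
SGA1** — the assembled proof `voisin2007_algebraic_of_finite_monodromyOrbit_of_qbar_of_inputs`
(`HodgeGenericQbarDescentFiniteMonodromyProofs.lean`) with its covering input supplied by
`finiteCovering_descends_to_qbar_of_riemannExistence_of_smooth`, its compactification input by
`exists_smoothProjective_baseChangeHom_compactification_familyPullback_of_isQuasiProjectiveOver`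
(Hironaka PROVED, EGA II not needed), and its pull-back input by the named fact
`fulton1998_map_mem_algebraicClasses`. Remaining inputs:

* `hRiemann` — Riemann existence theorem [SGA1, Exp. XII Thm. 5.1];
* `hDescent` — finite étale covers of `S₀ ⊗_{ℚ̄} ℂ` descend to `ℚ̄` [SGA1, Exp. XIII Prop. 4.6];
* `hGICT` — the named fact `deligne_globalInvariantCycles` [Deligne, Hodge II, Thm. 4.1.1];
* `hpol` — the named fact `smoothProjective_hodgeStructure_isPolarizable` [Voisin I, Thm. 6.32];
* `hPull` — the named fact `fulton1998_map_mem_algebraicClasses` [Fulton 1998, Cor. 19.2 (b)].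
[cite: Voisin2007HodgeLoci, §3, proof of Prop. 1.7 (arXiv math/0605766 p. 7; Compositio Prop. 0.7)]
[cite: SGA1, Exp. XII Thm. 5.1 and Exp. XIII Prop. 4.6] [cite: Hironaka1964, Main Theorem I]
[cite: DeligneHodgeII1971, Théorème 4.1.1] [cite: Fulton1998, Cor. 19.2 (b)] -/
theorem voisin2007_algebraic_of_finite_monodromyOrbit_of_qbar_of_riemannExistence'
    (hRiemann : ∀ (S : SchemeOver ℂ), IsQuasiProjectiveOver S → ∀ (T : Type) [TopologicalSpace T] (q : T → ComplexPoints S), IsCoveringMap q → (∀ t, (q ⁻¹' {t}).Finite) → ∃ (S' : SchemeOver ℂ) (g : S' ⟶ S) (Φ : ComplexPoints S' ≃ₜ T), IsFinite g.left ∧ Etale g.left ∧ ∀ z, q (Φ z) = AlgPoints.map g z)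
    (hDescent : ∀ (σ : AlgebraicClosure ℚ →+* ℂ) (S₀ : SchemeOver (AlgebraicClosure ℚ)), IsQuasiProjectiveOver S₀ → IrreducibleSpace S₀.left → ∀ ⦃S' : SchemeOver ℂ⦄ (g : S' ⟶ (baseChangeHom σ).obj S₀), IsFinite g.left → Etale g.left → ConnectedSpace S'.left → ∃ (S''₀ : SchemeOver (AlgebraicClosure ℚ)) (g₀ : S''₀ ⟶ S₀) (e : (baseChangeHom σ).obj S''₀ ≅ S'), IsFinite g₀.left ∧ Etale g₀.left ∧ e.hom ≫ g = (baseChangeHom σ).map g₀)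
    (hGICT : deligne_globalInvariantCycles) (hpol : smoothProjective_hodgeStructure_isPolarizable) :
    voisin2007_algebraic_of_finite_monodromyOrbit_of_qbar :=
  voisin2007_algebraic_of_finite_monodromyOrbit_of_qbar_of_riemannExistence hRiemann hDescent hGICT hpol fulton1998_map_mem_algebraicClasses_holds'

/-- (Hypothesis-free form of `voisin2007_algebraic_of_finite_monodromyOrbit_of_qbar_of_namedFacts`: `fulton1998_map_mem_algebraicClasses` is now a Literature
theorem, `fulton1998_map_mem_algebraicClasses_holds'`.) **Voisin 2007, Prop. 0.7 (= arXiv Prop. 1.7) from FOUR NAMED FACTS of the tree** — the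
assembled proof `voisin2007_algebraic_of_finite_monodromyOrbit_of_qbar_of_classical_inputs`
(`HodgeGenericQbarDescentProofs.lean`: finite orbit ⟹ finite-index stabiliser; the étale cover;
invariance on the cover; global invariant cycles; Hodge classes of the compactification; the Hodge
conjecture applied there; restriction back) with

* `hRE` := the named fact `FundamentalGroup.riemannExistence_qbarDescent_of_finiteIndex`
  (Riemann existence with descent to `ℚ̄`, SGA1 XII Thm. 5.1 and XIII Prop. 4.6, in the
  `π₁`/finite-index shape; its proved projection `.hRE`);
* `hComp` := PROVED here
  (`exists_smoothProjective_baseChangeHom_compactification_familyPullback_of_isQuasiProjectiveOver`: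
  Hironaka's smooth projective compactification over `ℚ̄` from the strong projective resolution
  `Resolution/ProjectiveStrongResolution.lean`, quasi-projectivity of the fibre product by Segre and
  the diagonal; the conclusion is transported to `ℂ` by `IsSmoothProjective.baseChangeHom_holds`);
* `hD` := the named fact `deligne_globalInvariantCycles` (Deligne, Hodge II, Thm. 4.1.1);
* `hpol` := the named fact `smoothProjective_hodgeStructure_isPolarizable` (Voisin I, Thm. 6.32);
* `hPull` := the named fact `fulton1998_map_mem_algebraicClasses` (Fulton 1998, Cor. 19.2 (b)),
  whose statement is verbatim the hypothesis.

Hence the named fact `voisin2007_algebraic_of_finite_monodromyOrbit_of_qbar` is reduced, inside the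
tree and with no anonymous hypothesis left, to these four vendored classical theorems.
[cite: Voisin2007HodgeLoci, §3, proof of Prop. 1.7 (arXiv math/0605766 p. 7; Compositio 143 (2007) Prop. 0.7)]
[cite: SGA1, Exp. XII Thm. 5.1 and Exp. XIII Prop. 4.6] [cite: Hironaka1964, Main Theorem I]
[cite: DeligneHodgeII1971, Théorème 4.1.1] [cite: Fulton1998, Cor. 19.2 (b)] -/
theorem voisin2007_algebraic_of_finite_monodromyOrbit_of_qbar_of_namedFacts'
    (hRE : FundamentalGroup.riemannExistence_qbarDescent_of_finiteIndex)
    (hGICT : deligne_globalInvariantCycles) (hpol : smoothProjective_hodgeStructure_isPolarizable) :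
    voisin2007_algebraic_of_finite_monodromyOrbit_of_qbar :=
  voisin2007_algebraic_of_finite_monodromyOrbit_of_qbar_of_namedFacts hRE hGICT hpol fulton1998_map_mem_algebraicClasses_holds'

end Literature.AlgebraicGeometry.HodgeTheory

namespace Literature.AlgebraicGeometry.HodgeTheory.BettiUniverse

/-! ### From `BettiUniverseCupChainMatchings` -/

/-- (Hypothesis-free form of `ofRatClass_sum_smul_cupChain_mem_algebraicClasses`: `fulton1998_map_mem_algebraicClasses` is now a Literature
theorem, `fulton1998_map_mem_algebraicClasses_holds'`.) **Re-summation of a matching insertion.** Let `x(w) ∈ H^{2p}(Y; ℚ)`, `w : Fin r → ι`, be the classes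
`wdec ∪ π_{u 0}^* b_{w 0} ∪ ⋯ ∪ π_{u (r−1)}^* b_{w (r−1)}` (left-nested, a sigma equation — the routes'
Künneth normal form), `e : Fin r ≃ Fin 2 × Fin j` a pairing of the slots and `Θₘ` matrices whose
two-slot insertions `Σ Θₘ[i,i'] f^*bᵢ ∪ g^*b_{i'}` have algebraic complexification for all `f, g : Y ⟶ X`.
Then the contraction `Σ_w (∏ₘ Θₘ[w(e⁻¹(0,m)), w(e⁻¹(1,m))]) · x(w)` has algebraic complexification:
sorting the slots pair by pair costs a global sign (`foldl_cupList_ofFn_perm`), the sorted chain is a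
chain of pairs (`foldl_cupList_flatten_pairs`), and the pair chain contracts to `± wdec ∪ D₀ ∪ ⋯`
(`ofRatClass_sum_smul_pairChain_mem_algebraicClasses`). This is the geometric half ("Künneth components
of graph classes, cup and pull-back closure") of the algebraicity of matching-tensor insertions.
[cite: VoisinHodgeII2003, proof of Prop. 9.20 and Prop. 9.21 (i)] [cite: Fulton1998, §19.2 Cor. 19.2 (b)]
[cite: HatcherAT2002, §3.2 Thm. 3.11] -/
theorem ofRatClass_sum_smul_cupChain_mem_algebraicClasses'
    {X Y : SchemeOver ℂ} {n : ℕ} {l : ℕ} (hY : IsSmoothProjective l Y) (h2 : n + n = 2 * n)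
    {ι : Type*} [Fintype ι] [DecidableEq ι] (bX : ι → bettiCohomology X n) {m : ℕ}
    (π : Fin (m + 1) → (Y ⟶ X)) {r : ℕ} (u : Fin r → Fin (m + 1)) (q : ℕ)
    (wdec : bettiCohomology Y (2 * q))
    (hwdec : ofRatClass (ComplexPoints Y) (2 * q) wdec ∈ algebraicClasses Y q) (p : ℕ)
    (x : (Fin r → ι) → bettiCohomology Y (2 * p))
    (hx : ∀ w, (⟨2 * p, x w⟩ : Σ i, bettiCohomology Y i) = List.foldl (fun (acc : Σ i, bettiCohomology Y i) (i : Fin r) => ⟨acc.1 + n, cup Y acc.1 n acc.2 (pull (π (u i)) n (bX (w i)))⟩) ⟨2 * q, wdec⟩ (List.finRange r))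
    {j : ℕ} (e : Fin r ≃ Fin 2 × Fin j) (Θ : Fin j → ι → ι → ℚ)
    (hΘ : ∀ (mm : Fin j) (f g : Y ⟶ X), ofRatClass (ComplexPoints Y) (2 * n) (∑ i, ∑ i', Θ mm i i' • bettiCup h2 (pull f n (bX i)) (pull g n (bX i'))) ∈ algebraicClasses Y n) :
    ofRatClass (ComplexPoints Y) (2 * p) (∑ w : Fin r → ι, (∏ mm, Θ mm (w (e.symm (0, mm))) (w (e.symm (1, mm)))) • x w) ∈ algebraicClasses Y p :=
  ofRatClass_sum_smul_cupChain_mem_algebraicClasses fulton1998_map_mem_algebraicClasses_holds' hY h2 bX π u q wdec hwdec p x hx e Θ hΘ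

end Literature.AlgebraicGeometry.HodgeTheory.BettiUniverse

namespace Literature.AlgebraicGeometry.HodgeTheory

/-! ### From `AlgebraicClassesLiftAlongMorphisms` -/

/-- (Hypothesis-free form of `exists_mem_algebraicClasses_map_eq_of_standardConjectureBStar`: `fulton1998_map_mem_algebraicClasses` is now a Literature
theorem, `fulton1998_map_mem_algebraicClasses_holds'`.) **Voisin 2025, Cor. 3.15 (i) AS PRINTED — "Assume `X` and `Y` satisfy the Lefschetz standard
conjecture".** With `B(X)`, `B(Y)` in André's `*_L`-form for every polarisation class
(`StandardConjectureBStar`), the multiplicativity of algebraic classes on `X × X` and `Y × Y` (Voisin II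
Prop. 9.20, the binders `hcupX`, `hcupY` of `HomologicalNumericalEquivalenceOfLefschetzStandard`, through
which the algebraic correspondence `*_L` acts on algebraic classes and gives `D(X)`, `D(Y)`), and the
pull-back functoriality of algebraic classes (Fulton Cor. 19.2 (b), the tree's named fact
`fulton1998_map_mem_algebraicClasses`, binder `hF`): for `φ : X → Y`, `2k + 2q = 2n`, `2k + 2q' = 2m`,
an algebraic `α = φ^* β ∈ Nᵏ(X)` is `φ^* β'` with `β' ∈ Nᵏ(Y)` algebraic.
[cite: Voisin2025, §3.2.2 Prop. 3.12 and Cor. 3.15 (i)] [cite: Fulton1998, §19.2 Cor. 19.2 (b)] -/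
theorem exists_mem_algebraicClasses_map_eq_of_standardConjectureBStar'
    {n m : ℕ} {X Y : Motives.SchemeOver ℂ} (hX : IsSmoothProjective n X)
    (hY : IsSmoothProjective m Y) (hBX : ∀ η : complexBetti X 2, StandardConjectureBStar n X η)
    (hBY : ∀ η : complexBetti Y 2, StandardConjectureBStar m Y η)
    (hcupX : ∀ (a b : ℕ) (x : complexBetti (X ⊗ X) (2 * a)) (y : complexBetti (X ⊗ X) (2 * b)), x ∈ algebraicClasses (X ⊗ X) a → y ∈ algebraicClasses (X ⊗ X) b → cupProduct (two_mul_add_two_mul a b) x y ∈ algebraicClasses (X ⊗ X) (a + b))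
    (hcupY : ∀ (a b : ℕ) (x : complexBetti (Y ⊗ Y) (2 * a)) (y : complexBetti (Y ⊗ Y) (2 * b)), x ∈ algebraicClasses (Y ⊗ Y) a → y ∈ algebraicClasses (Y ⊗ Y) b → cupProduct (two_mul_add_two_mul a b) x y ∈ algebraicClasses (Y ⊗ Y) (a + b))
    (φ : X ⟶ Y) {k q q' : ℕ} (hkq : 2 * k + 2 * q = 2 * n) (hkq' : 2 * k + 2 * q' = 2 * m)
    {α : complexBetti X (2 * k)} (hα : α ∈ algebraicClasses X k)
    (hαφ : α ∈ LinearMap.range (complexBetti.map φ (2 * k)).hom) :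
    ∃ β' ∈ algebraicClasses Y k, complexBetti.map φ (2 * k) β' = α :=
  exists_mem_algebraicClasses_map_eq_of_standardConjectureBStar fulton1998_map_mem_algebraicClasses_holds' hX hY hBX hBY hcupX hcupY φ hkq hkq' hα hαφ

/-- (Hypothesis-free form of `exists_mem_algebraicClasses_complexGysin_eq_of_standardConjectureBStar`: `fulton1998_map_mem_algebraicClasses` is now a Literature
theorem, `fulton1998_map_mem_algebraicClasses_holds'`.) **Cor. 3.15 (ii) AS PRINTED**, same hypotheses: an algebraic `α = φ_* β ∈ N^{q'}(Y)`
(`2q + 2m = 2q' + 2n`, `2q + 2k = 2n`, `2q' + 2k = 2m`, any orientation family `μ`) is `φ_* β'` with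
`β' ∈ N^q(X)` algebraic. [cite: Voisin2025, §3.2.2 Cor. 3.15 (ii)] [cite: Fulton1998, §19.2 Cor. 19.2 (b)] -/
theorem exists_mem_algebraicClasses_complexGysin_eq_of_standardConjectureBStar'
    {n m : ℕ} {X Y : Motives.SchemeOver ℂ} (μ : OrientationFamily) (hX : IsSmoothProjective n X)
    (hY : IsSmoothProjective m Y) (hBX : ∀ η : complexBetti X 2, StandardConjectureBStar n X η)
    (hBY : ∀ η : complexBetti Y 2, StandardConjectureBStar m Y η)
    (hcupX : ∀ (a b : ℕ) (x : complexBetti (X ⊗ X) (2 * a)) (y : complexBetti (X ⊗ X) (2 * b)), x ∈ algebraicClasses (X ⊗ X) a → y ∈ algebraicClasses (X ⊗ X) b → cupProduct (two_mul_add_two_mul a b) x y ∈ algebraicClasses (X ⊗ X) (a + b))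
    (hcupY : ∀ (a b : ℕ) (x : complexBetti (Y ⊗ Y) (2 * a)) (y : complexBetti (Y ⊗ Y) (2 * b)), x ∈ algebraicClasses (Y ⊗ Y) a → y ∈ algebraicClasses (Y ⊗ Y) b → cupProduct (two_mul_add_two_mul a b) x y ∈ algebraicClasses (Y ⊗ Y) (a + b))
    (φ : X ⟶ Y) {k q q' : ℕ} (hq : 2 * q + 2 * m = 2 * q' + 2 * n) (hqk : 2 * q + 2 * k = 2 * n)
    (hq'k : 2 * q' + 2 * k = 2 * m) {α : complexBetti Y (2 * q')} (hα : α ∈ algebraicClasses Y q')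
    (hαφ : α ∈ LinearMap.range (complexGysin μ hX hY φ hq)) :
    ∃ β' ∈ algebraicClasses X q, complexGysin μ hX hY φ hq β' = α :=
  exists_mem_algebraicClasses_complexGysin_eq_of_standardConjectureBStar fulton1998_map_mem_algebraicClasses_holds' μ hX hY hBX hBY hcupX hcupY φ hq hqk hq'k hα hαφ

end Literature.AlgebraicGeometry.HodgeTheory

namespace Literature.AlgebraicGeometry.HodgeTheory

/-! ### From `MotivatedClassesHodgeConjecture` -/

/-- (Hypothesis-free form of `hodgeConjectureFor_of_standardConjectureB_of_motivated_of_fulton1998`: `fulton1998_map_mem_algebraicClasses` is now a Literature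
theorem, `fulton1998_map_mem_algebraicClasses_holds'`.) **The same, modulo Fulton's Cor. 19.2 (b)** (pull-backs along morphisms of smooth projective
varieties preserve algebraic classes, the named fact `fulton1998_map_mem_algebraicClasses`,
equivalent on the coniveau carrier to Prop. 9.20, `fulton1998_map_mem_algebraicClasses_iff_cupProduct`).
[cite: Fulton1998, §19.2 Cor. 19.2 (b)] [cite: Andre1996Motifs, §2.1 remark following Déf. 1 (p. 14)] -/
theorem hodgeConjectureFor_of_standardConjectureB_of_motivated_of_fulton1998'
    (hB : ∀ (d : ℕ) (Z : Motives.SchemeOver ℂ) (η : complexBetti Z 2), Motives.IsSmoothProjective d Z → StandardConjectureBStar d Z η)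
    (hM : ∀ ⦃n : ℕ⦄ ⦃X : Motives.SchemeOver ℂ⦄, Motives.IsSmoothProjective n X → ∀ (p : ℕ) (c : complexBetti X (2 * p)), IsRationalClass c → IsOfHodgeType n X (2 * p) p p c → c ∈ motivatedClasses n X p)
    ⦃n : ℕ⦄ ⦃X : Motives.SchemeOver ℂ⦄ (hX : Motives.IsSmoothProjective n X) :
    HodgeConjectureFor n X :=
  hodgeConjectureFor_of_standardConjectureB_of_motivated_of_fulton1998 fulton1998_map_mem_algebraicClasses_holds' hB hM hX

end Literature.AlgebraicGeometry.HodgeTheory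

namespace Literature.AlgebraicGeometry.HodgeTheory

/-! ### From `MotivatedClassesHodgeConjecture` -/

/-- (Hypothesis-free form of `hodgeConjectureFor_of_standardConjectureB_of_motivated_of_cupProduct`: `Voisin2003_cupProduct_algebraicClasses` is now a Literature
theorem, `Voisin2003_cupProduct_algebraicClasses_holds'`.) **`B` for all ∧ Hodge ⟹ motivated for all ⟹ the Hodge conjecture for all, modulo Voisin II
Prop. 9.20 on the coniveau carrier** (André 1996, §0.3 p. 7 and §2.1 remark after Déf. 1, p. 14:
under `B`, `A_mot(X) = A(X)`; so a motivated Hodge class is algebraic). GIVEN the multiplicativity of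
algebraic classes on every smooth projective complex variety
(`hcup : Voisin2003_cupProduct_algebraicClasses`), IF `*_L` of every polarisation class of every
smooth projective `Z` is an algebraic correspondence (`hB`, `StandardConjectureBStar`) AND every
rational `(p,p)`-class of every smooth projective `X` is motivated (`hM`), THEN `HodgeConjectureFor n X`
for every smooth projective `X`: Hodge models exist (`nonempty_hodgeModel_holds`), and a rational
`(p,p)`-class is motivated (`hM`), hence algebraic by the tree's assembly
`Andre1996_motivatedClasses_le_algebraicClasses_of_standardConjectureB_holds_of hcup hB`.
[cite: Andre1996Motifs, §0.3 (p. 7) and §2.1 remark following Déf. 1 (p. 14)]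
[cite: VoisinHodgeII2003, §9.2.4 Prop. 9.20] -/
theorem hodgeConjectureFor_of_standardConjectureB_of_motivated_of_cupProduct'
    (hB : ∀ (d : ℕ) (Z : Motives.SchemeOver ℂ) (η : complexBetti Z 2), Motives.IsSmoothProjective d Z → StandardConjectureBStar d Z η)
    (hM : ∀ ⦃n : ℕ⦄ ⦃X : Motives.SchemeOver ℂ⦄, Motives.IsSmoothProjective n X → ∀ (p : ℕ) (c : complexBetti X (2 * p)), IsRationalClass c → IsOfHodgeType n X (2 * p) p p c → c ∈ motivatedClasses n X p)
    ⦃n : ℕ⦄ ⦃X : Motives.SchemeOver ℂ⦄ (hX : Motives.IsSmoothProjective n X) :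
    HodgeConjectureFor n X :=
  hodgeConjectureFor_of_standardConjectureB_of_motivated_of_cupProduct Voisin2003_cupProduct_algebraicClasses_holds' hB hM hX

/-- (Hypothesis-free form of `motivated_iff_hodgeConjectureFor_of_standardConjectureB_of_cupProduct`: `Voisin2003_cupProduct_algebraicClasses` is now a Literature
theorem, `Voisin2003_cupProduct_algebraicClasses_holds'`.) **In the `B`-world, "Hodge classes are motivated" IS the Hodge conjecture** (André 1996 §0.3–0.4:
motivated cycles reduce to algebraic cycles under `B`; conversely algebraic classes are motivated),
modulo Prop. 9.20 on the coniveau carrier: given `hcup` and `B` for all smooth projective `Z`,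
(every rational `(p,p)`-class on every smooth projective `X` is motivated) ↔ (the Hodge conjecture
holds for every smooth projective `X`). [cite: Andre1996Motifs, §0.3 (p. 7) and §2.1 remark following Déf. 1 (p. 14)]
[cite: VoisinHodgeII2003, §9.2.4 Prop. 9.20] -/
theorem motivated_iff_hodgeConjectureFor_of_standardConjectureB_of_cupProduct'
    (hB : ∀ (d : ℕ) (Z : Motives.SchemeOver ℂ) (η : complexBetti Z 2), Motives.IsSmoothProjective d Z → StandardConjectureBStar d Z η) :
    (∀ ⦃n : ℕ⦄ ⦃X : Motives.SchemeOver ℂ⦄, Motives.IsSmoothProjective n X → ∀ (p : ℕ) (c : complexBetti X (2 * p)), IsRationalClass c → IsOfHodgeType n X (2 * p) p p c → c ∈ motivatedClasses n X p) ↔ ∀ ⦃n : ℕ⦄ ⦃X : Motives.SchemeOver ℂ⦄, Motives.IsSmoothProjective n X → HodgeConjectureFor n X :=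
  motivated_iff_hodgeConjectureFor_of_standardConjectureB_of_cupProduct Voisin2003_cupProduct_algebraicClasses_holds' hB

end Literature.AlgebraicGeometry.HodgeTheory

namespace Literature.AlgebraicGeometry.HodgeTheory.DworkSextic

/-! ### From `DworkSexticReflectionTransfer` -/

/-- (Hypothesis-free form of `mem_algebraicClasses_of_isRefl_invariant_of_BG`: `fulton1998_map_mem_algebraicClasses` is now a Literature
theorem, `fulton1998_map_mem_algebraicClasses_holds'`.) **Reflection-invariant rational `(2,2)`-classes on the Dwork sextic are algebraic** (`ψ⁶ ≠ 1`),
granted Bini–Garbagnati Prop. 3.20 and Fulton's pull-back shape ONLY — Bredon's transfer, the third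
hypothesis of the tree's `mem_algebraicClasses_of_isRefl_invariant`, is now the theorem
`reflTransfer`. Proof: `c = p^* d` with `d` rational of type `(2,2)` on `Z = X_ψ/⟨s⟩`
(`exists_rational_hodge_map_reflQuotientMap_eq_of_BG`); `d` is algebraic by the Hodge conjecture
for the smooth projective rationally chain connected fourfold `Z` (`hodgeConjectureFor_reflQuotient`,
Bloch–Srinivas); `p^* d` is algebraic (Fulton). [cite: BiniGarbagnati2012, Prop. 3.20]
[cite: Fulton1998, §19.2 Cor. 19.2 (b)] [cite: BlochSrinivas1983, Thm. 1 (3)] -/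
theorem mem_algebraicClasses_of_isRefl_invariant_of_BG'
    {ψ : ℂ} (hψ : ψ ^ 6 ≠ 1) {i j : Fin 6} (hij : i ≠ j) {ζ : ℂ} (hζ : ζ ^ 6 = 1)
    (h : BiniGarbagnati2012_reflectionQuotient_smoothProjective_rcc)
    {g : C(Motives.ComplexPoints (fibre ψ), Motives.ComplexPoints (fibre ψ))}
    (hg : ∀ x, ∃ t : ℂ, (pt ψ (g x)).rep = t • (fun k => if k = i then ζ * (pt ψ x).rep j else if k = j then ζ⁻¹ * (pt ψ x).rep i else (pt ψ x).rep k))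
    {c : complexBetti (fibre ψ) (2 * 2)} (hcr : IsRationalClass c)
    (hct : IsOfHodgeType 4 (fibre ψ) (2 * 2) 2 2 c)
    (hc : singularCohomology.map ℂ ℂ g (2 * 2) c = c) :
    c ∈ algebraicClasses (fibre ψ) 2 :=
  mem_algebraicClasses_of_isRefl_invariant_of_BG hψ hij hζ h fulton1998_map_mem_algebraicClasses_holds' hg hcr hct hc

end Literature.AlgebraicGeometry.HodgeTheory.DworkSextic

namespace Literature.AlgebraicGeometry.HodgeTheory.DworkSextic

open Literature.AlgebraicTopology.SingularHomology

/-! ### From `DworkSexticReflectionQuotient` -/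

/-- (Hypothesis-free form of `mem_algebraicClasses_of_isRefl_invariant`: `fulton1998_map_mem_algebraicClasses` is now a Literature
theorem, `fulton1998_map_mem_algebraicClasses_holds'`.) **Reflection-invariant rational `(2,2)`-classes on the Dwork sextic are algebraic** (`ψ⁶ ≠ 1`),
granted the three named facts: the transfer (Bredon II.19.2), Bini–Garbagnati Prop. 3.20, and the
pull-back of algebraic classes along morphisms of smooth projective varieties (Fulton Cor. 19.2 (b)).
Proof: `c = p^* d` with `d` rational of type `(2,2)` on `Z = X_ψ/⟨s⟩`
(`exists_rational_hodge_map_reflQuotientMap_eq`); `d` is algebraic on `Z` by the Hodge conjecture for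
`Z` (`hodgeConjectureFor_reflQuotient`: `Z` is a smooth projective rationally chain connected
fourfold); `p^* d` is algebraic on `X_ψ` (Fulton). [cite: BiniGarbagnati2012, Prop. 3.20]
[cite: Bredon1997, II Thm. 19.2] [cite: Fulton1998, §19.2 Cor. 19.2 (b)] [cite: BlochSrinivas1983, Thm. 1 (3)] -/
theorem mem_algebraicClasses_of_isRefl_invariant'
    {ψ : ℂ} {i j : Fin 6} {ζ : ℂ} (hψ : ψ ^ 6 ≠ 1) (hij : i ≠ j) (hζ : ζ ^ 6 = 1)
    (hB : bredon1997_quotient_cohomology_invariants)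
    (h : BiniGarbagnati2012_reflectionQuotient_smoothProjective_rcc)
    {g : C(Motives.ComplexPoints (fibre ψ), Motives.ComplexPoints (fibre ψ))}
    (hg : ∀ x, ∃ t : ℂ, (pt ψ (g x)).rep = t • (fun k => if k = i then ζ * (pt ψ x).rep j else if k = j then ζ⁻¹ * (pt ψ x).rep i else (pt ψ x).rep k))
    {c : complexBetti (fibre ψ) (2 * 2)} (hcr : IsRationalClass c)
    (hct : IsOfHodgeType 4 (fibre ψ) (2 * 2) 2 2 c)
    (hc : singularCohomology.map ℂ ℂ g (2 * 2) c = c) :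
    c ∈ algebraicClasses (fibre ψ) 2 :=
  mem_algebraicClasses_of_isRefl_invariant hψ hij hζ hB h fulton1998_map_mem_algebraicClasses_holds' hg hcr hct hc

end Literature.AlgebraicGeometry.HodgeTheory.DworkSextic

namespace Literature.AlgebraicGeometry.HodgeTheory

/-! ### From `HomologicalNumericalEquivalenceOfLefschetzStandard` -/

/-- (Hypothesis-free form of `eq_zero_of_mem_algebraicClasses_of_forall_pairing_eq_zero_of_standardConjectureBStar_of_cupProduct_algebraicClasses`: `Voisin2003_cupProduct_algebraicClasses` is now a Literature
theorem, `Voisin2003_cupProduct_algebraicClasses_holds'`.) `B(X) ⟹ D(X)` over `ℂ`, with the multiplicativity of algebraic classes in the packaged form of the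
tree's named fact `Voisin2003_cupProduct_algebraicClasses` (Voisin II Prop. 9.20, a theorem in print)
as the hypothesis. [cite: Murre2004LecturesMotives, §4.2.1.4 (1)] [cite: VoisinHodgeII2003, §9.2.4 Prop. 9.20] -/
theorem eq_zero_of_mem_algebraicClasses_of_forall_pairing_eq_zero_of_standardConjectureBStar_of_cupProduct_algebraicClasses'
    {n : ℕ} {X : Motives.SchemeOver ℂ} (hX : IsSmoothProjective n X)
    (hB : ∀ η : complexBetti X 2, StandardConjectureBStar n X η) {p q : ℕ}
    (hpq : 2 * p + 2 * q = 2 * n) (μ : HomologicalOrientation ℤ (Motives.ComplexPoints X) (2 * n))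
    {x : singularCohomology ℚ ℚ (Motives.ComplexPoints X) (2 * p)}
    (hx : ofRatClass (Motives.ComplexPoints X) (2 * p) x ∈ algebraicClasses X p)
    (hnum : ∀ z : singularCohomology ℚ ℚ (Motives.ComplexPoints X) (2 * q), ofRatClass (Motives.ComplexPoints X) (2 * q) z ∈ algebraicClasses X q → kroneckerPairing ℚ ℚ (Motives.ComplexPoints X) (2 * n) (cupProduct hpq x z) (singularHomology.coeffChange (Motives.ComplexPoints X) (algebraMap ℤ ℚ : ℤ →+* ℚ).toAddMonoidHom (2 * n) μ.fundamentalClass) = 0) :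
    x = 0 :=
  eq_zero_of_mem_algebraicClasses_of_forall_pairing_eq_zero_of_standardConjectureBStar_of_cupProduct_algebraicClasses hX hB Voisin2003_cupProduct_algebraicClasses_holds' hpq μ hx hnum

end Literature.AlgebraicGeometry.HodgeTheory

end
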